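import Literature.Computability.Cryptography.PeikertBDDIdealised
import Literature.Computability.Cryptography.CryptoFoundationsWave0
import Literature.Computability.Complexity.Classes
import Mathlib.Analysis.Complex.ExponentialBounds
import Mathlib.Analysis.Real.Pi.Bounds
import HarnessLib

/-!
# Peikert 2009, Prop. 3.2: a polynomial parameter schedule under which the idealised `BDD → LWE` reduction fails with negligible probability

Topic `Computability/Cryptography` (family `pqc`), grouping namespace `Peikert2009`; sequel of
`PeikertBDDIdealised.lean` (`toReal_regevBDD_ne_le_of_admissible`: on an `f`-admissible input of
dimension `n` the idealised reduction `Regev2009.regevBDD` misses the closest vector with probability at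
most `(K_g+1)J(m+N_V)(δ + 6·2⁻ⁿ) + (K_g+1)J·η_A + 2^{-J}` for any verification test with error bounds
`(η_A, η_R ≤ 1/7)`; Regev's cosine test has `η_A = e^{-N_V e^{-2πα²}/32}`). Everything here is PROVED
(theorems, plus the schedule as definitions WITH BODIES); no named fact.

This file closes the ANALYSIS of the second component `h₂` of
`peikert_gapSVPZeta_to_lwe_classical_of_components` (Peikert's Prop. 3.2 with the `pqc` oracle): with
the polynomial schedule `K_g = 24m + 1` levels, `J = n + 1` attempts, `N_V = 800000(n+1)` verification
samples and the fine rounding factor `K = 512` (absolute constants chosen so that the two numerical side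
conditions `4πe^{πα²} ≤ qK` and `e^{-N_V e^{-2πα²}/128} ≤ 1/7` hold for every `q ≥ 2`, `α < 1` — only
`e < 2.72` and `π ≤ 4` are used), the failure bound is NEGLIGIBLE whenever `m` is polynomially bounded,
the lattice sampler is within a negligible `δ(n)` of `D_{L(B)*,r}` and the test's `η_A(n)` is negligible
(`isNegligible_failureBound`; for the cosine test `η_A(n) = e^{-N_V(n)e^{-2πα²}/32} ≤ 2⁻ⁿ`,
`exp_schedNV_le_two_inv_pow`), hence eventually `≤ n^{-c}` for every `c` (`eventually_failureBound_le`);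
combined with `toReal_regevBDD_ne_le_of_admissible` this is Prop. 3.2's "with overwhelming probability"
for the idealised reduction, in the `∀ c, ∀ᶠ n, … ≥ 1 - n^{-c}` format of `Peikert2009.SolvesBDD`:
`regevBDD_solves_eventually_of_test` (any family of tests with negligible `η_A` and `η_R ≤ 1/7`, e.g. a
machine's rounded-cosine test) and `regevBDD_solves_eventually` (Regev's cosine test, `K = 512`,
`N_V = 800000(n+1)`). The machine realising `regevBDD` is not in this file.

## References

* C. Peikert, *Public-key cryptosystems from the worst-case shortest vector problem*, STOC 2009,
  Prop. 3.2 and the proof of Thm. 3.1 (full version pp. 11–12) [Peikert2009].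
* O. Regev, *On lattices, learning with errors, random linear codes, and cryptography*, J. ACM 56
  (2009), art. 34, Lemma 3.4 with Lemmas 3.6–3.7 ("a polynomial number of samples", "exponentially
  close to `1`") [RegevLWE2009].
-/

noncomputable section

open Finset Filter Asymptotics Metric
open scoped ENNReal Real Topology

namespace Literature.Computability.Cryptography

namespace Peikert2009

open Literature.Probability.Distributions Literature.Algebra.EuclideanLattices
  Literature.Computability.Complexity Regev2009 LWE

/-! ### The schedule -/

/-- LOCAL GLUE. Number of padding levels minus one: `K_g(n) = 24·m(n) + 1` (`≥ max(1, 24m)`). [cite: RegevLWE2009, Lemma 3.7 (proof: "the set `Z` of all integer multiples of `n^{-2c}α²`")] -/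
def schedKg (m : ℕ → ℕ) (n : ℕ) : ℕ := 24 * m n + 1

/-- LOCAL GLUE. Attempts per level: `J(n) = n + 1`. [cite: RegevLWE2009, Lemma 3.7 (proof: "repeat … `n` times")] -/
def schedJ (n : ℕ) : ℕ := n + 1

/-- LOCAL GLUE. Verification samples: `N_V(n) = 800000·(n + 1)` (`≥ 256·e⁸·(n+1)`, so that
`N_V e^{-2πα²}/128 ≥ 2(n+1)` for `α < 1`). [cite: RegevLWE2009, Lemma 3.6 (proof: "`n` samples")] -/
def schedNV (n : ℕ) : ℕ := 800000 * (n + 1)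

/-- LOCAL GLUE. The fine rounding factor `K = 512` (`qK ≥ 1024 ≥ 4πe^{π}` for `q ≥ 2`). [folklore] -/
def schedK : ℕ := 512

/-! ### Numerical side conditions -/

/-- `e⁴ < 54.6`. [folklore] -/
theorem exp_four_lt : Real.exp 4 < 54.6 := by
  have h : Real.exp 4 = Real.exp 1 ^ 4 := by rw [← Real.exp_nat_mul]; norm_num
  rw [h]
  have h1 := Real.exp_one_lt_d9
  have h0 : 0 < Real.exp 1 := Real.exp_pos 1
  calc Real.exp 1 ^ 4 < (2.7182818286 : ℝ) ^ 4 := by gcongr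
    _ < 54.6 := by norm_num

/-- `e⁸ < 3000`. [folklore] -/
theorem exp_eight_lt : Real.exp 8 < 3000 := by
  have h : Real.exp 8 = Real.exp 4 ^ 2 := by rw [← Real.exp_nat_mul]; norm_num
  rw [h]
  have h0 : 0 < Real.exp 4 := Real.exp_pos 4
  calc Real.exp 4 ^ 2 < (54.6 : ℝ) ^ 2 := by gcongr; exact exp_four_lt
    _ < 3000 := by norm_num

/-- `K = 512 ≠ 0` (needed for the types `ZMod (q·K)`). [folklore] -/
instance instNeZeroSchedK : NeZero schedK := ⟨by norm_num [schedK]⟩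



/-- **The modulus condition**: `4πe^{πα²} ≤ q·512` for `q ≥ 2`, `|α| ≤ 1`. [folklore] -/
theorem hqK_sched {q : ℕ} (hq : 2 ≤ q) {α : ℝ} (hα : |α| ≤ 1) :
    4 * π * Real.exp (π * α ^ 2) ≤ (q * schedK : ℕ) := by
  have hα2 : α ^ 2 ≤ 1 := by
    have h := pow_le_one₀ (abs_nonneg α) hα (n := 2)
    rwa [sq_abs] at h
  have h1 : Real.exp (π * α ^ 2) ≤ Real.exp 4 :=
    Real.exp_le_exp.2 (by nlinarith [Real.pi_le_four, Real.pi_pos])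
  have h2 : (4 * π * Real.exp (π * α ^ 2)) ≤ 4 * 4 * 54.6 := by
    have := exp_four_lt
    have hπ := Real.pi_le_four
    have hπ0 := Real.pi_pos
    have he0 := Real.exp_pos (π * α ^ 2)
    nlinarith
  have h3 : ((q * schedK : ℕ) : ℝ) ≥ 2 * 512 := by
    rw [schedK]; push_cast; nlinarith [show (2:ℝ) ≤ q by exact_mod_cast hq]
  linarith

/-- `e^{-2πα²} ≥ e^{-8}` for `|α| ≤ 1`. [folklore] -/
theorem exp_neg_eight_le {α : ℝ} (hα : |α| ≤ 1) : Real.exp (-8) ≤ Real.exp (-(2 * π * α ^ 2)) := by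
  have hα2 : α ^ 2 ≤ 1 := by
    have h := pow_le_one₀ (abs_nonneg α) hα (n := 2)
    rwa [sq_abs] at h
  exact Real.exp_le_exp.2 (by nlinarith [Real.pi_le_four, Real.pi_pos, sq_nonneg α])

/-- **The exponent of the schedule**: `N_V(n)·e^{-2πα²}/128 ≥ 2(n+1)` for `|α| ≤ 1`. [folklore] -/
theorem two_mul_le_schedNV_mul (n : ℕ) {α : ℝ} (hα : |α| ≤ 1) :
    2 * ((n : ℝ) + 1) ≤ schedNV n * Real.exp (-(2 * π * α ^ 2)) / 128 := by
  have h1 := exp_neg_eight_le hα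
  have h8 : (1 : ℝ) / 3000 ≤ Real.exp (-8) := by
    rw [Real.exp_neg, one_div]
    exact inv_anti₀ (Real.exp_pos 8) exp_eight_lt.le
  rw [schedNV]
  push_cast
  have hn : (0 : ℝ) ≤ n := Nat.cast_nonneg n
  have : (1 : ℝ) / 3000 ≤ Real.exp (-(2 * π * α ^ 2)) := h8.trans h1
  nlinarith

/-- **The verification condition**: `e^{-N_V(n) e^{-2πα²}/128} ≤ 1/7` for `|α| ≤ 1` (`ln 7 < 2 ≤` the
exponent). [folklore] -/
theorem hNV_sched (n : ℕ) {α : ℝ} (hα : |α| ≤ 1) :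
    Real.exp (-(schedNV n * Real.exp (-(2 * π * α ^ 2)) / 128)) ≤ 1 / 7 := by
  have h := two_mul_le_schedNV_mul n hα
  have hn : (0 : ℝ) ≤ n := Nat.cast_nonneg n
  have h2 : Real.exp (-(schedNV n * Real.exp (-(2 * π * α ^ 2)) / 128)) ≤ Real.exp (-2) :=
    Real.exp_le_exp.2 (by linarith)
  refine h2.trans ?_
  -- `e^{-2} ≤ 1/7` iff `7 ≤ e²`
  rw [Real.exp_neg, inv_eq_one_div, one_div_le_one_div (Real.exp_pos 2) (by norm_num : (0:ℝ) < 7)]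
  have h3 : Real.exp 2 = Real.exp 1 ^ 2 := by rw [← Real.exp_nat_mul]; norm_num
  rw [h3]
  have h4 := Real.exp_one_gt_d9
  nlinarith

/-- The exponential term of the schedule: `e^{-N_V(n) e^{-2πα²}/32} ≤ 2⁻ⁿ` for `|α| ≤ 1`. [folklore] -/
theorem exp_schedNV_le_two_inv_pow (n : ℕ) {α : ℝ} (hα : |α| ≤ 1) :
    Real.exp (-(schedNV n * Real.exp (-(2 * π * α ^ 2)) / 32)) ≤ (2⁻¹ : ℝ) ^ n := by
  have h := two_mul_le_schedNV_mul n hα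
  have hn : (0 : ℝ) ≤ n := Nat.cast_nonneg n
  -- exponent `≥ 8(n+1) ≥ n`, and `e^{-n} ≤ 2^{-n}`
  have h32 : (schedNV n : ℝ) * Real.exp (-(2 * π * α ^ 2)) / 32 =
      4 * (schedNV n * Real.exp (-(2 * π * α ^ 2)) / 128) := by ring
  have h1 : Real.exp (-(schedNV n * Real.exp (-(2 * π * α ^ 2)) / 32)) ≤ Real.exp (-(n : ℝ)) :=
    Real.exp_le_exp.2 (by rw [h32]; linarith)
  refine h1.trans ?_
  rw [show -(n : ℝ) = n * (-1) by ring, Real.exp_nat_mul]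
  apply pow_le_pow_left₀ (Real.exp_pos _).le
  rw [Real.exp_neg]
  exact inv_anti₀ two_pos (by linarith [Real.add_one_le_exp (1 : ℝ)])

/-! ### The failure bound of the schedule is negligible -/

/-- LOCAL GLUE. The failure bound of `PeikertBDDIdealised.toReal_regevBDD_ne_le_of_admissible` under the
schedule, as a function of `n` (sampler error `δ`, verification samples `N_V`, false-acceptance bound
`η_A` of the verification test). [cite: Peikert2009, Prop. 3.2 (proof via Regev 2009, Lemma 3.4)] -/
def failureBound (m NV : ℕ → ℕ) (δ ηA : ℕ → ℝ) (n : ℕ) : ℝ :=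
  ((schedKg m n + 1) * schedJ n : ℕ) * ((m n + NV n) * (δ n + 6 * (2⁻¹ : ℝ) ^ n)) +
    (((schedKg m n + 1) * schedJ n : ℕ) * ηA n + (1 / 2) ^ schedJ n)

/-- Negligible sequences: eventually `≤ n^{-c}`. [folklore] -/
theorem eventually_le_of_isNegligible {μ : ℕ → ℝ} (h : IsNegligible μ) (c : ℕ) :
    ∀ᶠ n : ℕ in atTop, μ n ≤ 1 / (n : ℝ) ^ c := by
  have h1 : ∀ᶠ n : ℕ in atTop, (n : ℝ) ^ c * μ n < 1 := (h c).eventually (gt_mem_nhds zero_lt_one)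
  filter_upwards [h1, eventually_ge_atTop 1] with n hn h1n
  have hpos : (0 : ℝ) < (n : ℝ) ^ c := by positivity
  rw [le_div_iff₀ hpos, mul_comm]
  exact hn.le

/-- **The failure bound is negligible** for polynomially bounded `m` and `N_V`, negligible sampler error
`δ ≥ 0` and negligible false-acceptance bound `η_A ≥ 0`: every term is a polynomial times
`δ + η_A + 2⁻ⁿ`. [cite: Peikert2009, Prop. 3.2 ("with overwhelming probability"); RegevLWE2009, Lemma 3.4] -/
theorem isNegligible_failureBound {m NV : ℕ → ℕ} (hm : IsPolyBounded m) (hNV : IsPolyBounded NV)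
    {δ ηA : ℕ → ℝ} (hδ : IsNegligible δ) (hδ0 : ∀ n, 0 ≤ δ n) (hηA : IsNegligible ηA) (hηA0 : ∀ n, 0 ≤ ηA n) :
    IsNegligible (failureBound m NV δ ηA) := by
  obtain ⟨P, hP⟩ := hm
  obtain ⟨C, k, hCk⟩ := exists_eval_le_mul_pow_add P
  obtain ⟨P', hP'⟩ := hNV
  obtain ⟨C', k', hCk'⟩ := exists_eval_le_mul_pow_add P'
  have hmle : ∀ n, (m n : ℝ) ≤ C * n ^ k + C := fun n => by exact_mod_cast (hP n).trans (hCk n)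
  have hNVle : ∀ n, (NV n : ℝ) ≤ C' * n ^ k' + C' := fun n => by exact_mod_cast (hP' n).trans (hCk' n)
  -- a dominating polynomial: `Q(n) = 7 (24(Cn^k + C) + 2)(n + 1)((Cn^k + C) + (C'n^k' + C') + 1) + 1`
  set Q : Polynomial ℝ := 7 * (24 * (Polynomial.C (C : ℝ) * Polynomial.X ^ k + Polynomial.C (C : ℝ)) + 2) *
    (Polynomial.X + 1) * ((Polynomial.C (C : ℝ) * Polynomial.X ^ k + Polynomial.C (C : ℝ)) +
      (Polynomial.C (C' : ℝ) * Polynomial.X ^ k' + Polynomial.C (C' : ℝ)) + 1) + 1 with hQ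
  have hQeval : ∀ n : ℕ, Q.eval (n : ℝ) =
      7 * (24 * (C * n ^ k + C) + 2) * (n + 1) * ((C * n ^ k + C) + (C' * n ^ k' + C') + 1) + 1 := fun n => by
    simp [hQ]
  -- `2⁻ⁿ` is negligible (the tree's `Regev2009.isNegligible_two_inv_pow`, `RegevReduction.lean`; the
  -- one-line argument is repeated here rather than importing the quantum-reduction file)
  have hhalf : IsNegligible fun n : ℕ => (2⁻¹ : ℝ) ^ n := fun c =>
    tendsto_pow_const_mul_const_pow_of_abs_lt_one c (by rw [abs_of_pos (by positivity)]; norm_num)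
  have hneg : IsNegligible fun n => Q.eval (n : ℝ) * (δ n + ηA n + (2⁻¹ : ℝ) ^ n) :=
    ((hδ.add hηA).add hhalf).polynomial_mul Q
  refine hneg.trans_eventually_abs_le (Filter.Eventually.of_forall fun n => ?_)
  simp only [Function.comp_apply]
  have hn : (0 : ℝ) ≤ n := Nat.cast_nonneg n
  have h2n : (0 : ℝ) ≤ (2⁻¹ : ℝ) ^ n := by positivity
  have hδn := hδ0 n
  have hηn := hηA0 n
  set A : ℝ := C * n ^ k + C with hA
  set A' : ℝ := C' * n ^ k' + C' with hA'
  have hA0 : 0 ≤ A := by positivity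
  have hA'0 : 0 ≤ A' := by positivity
  -- sizes of the schedule
  have hKg : ((schedKg m n + 1 : ℕ) : ℝ) ≤ 24 * A + 2 := by
    rw [schedKg]; push_cast; linarith [hmle n]
  have hJ : ((schedJ n : ℕ) : ℝ) = n + 1 := by rw [schedJ]; push_cast; ring
  have hNVm : (m n : ℝ) + NV n ≤ A + A' + 1 := by linarith [hmle n, hNVle n]
  have hhalf : ((1 : ℝ) / 2) ^ schedJ n ≤ (2⁻¹ : ℝ) ^ n := by
    rw [schedJ, one_div]
    exact pow_le_pow_of_le_one (by norm_num) (by norm_num) (Nat.le_succ n)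
  -- the bound is nonnegative, so `|·| = ·`
  have hB0 : 0 ≤ failureBound m NV δ ηA n := by unfold failureBound; positivity
  rw [abs_of_nonneg hB0, abs_of_nonneg (mul_nonneg (by rw [hQeval]; positivity) (by positivity))]
  unfold failureBound
  rw [hQeval]
  have hKJ : (((schedKg m n + 1) * schedJ n : ℕ) : ℝ) ≤ (24 * A + 2) * (n + 1) := by
    push_cast [Nat.cast_mul]
    rw [show ((schedJ n : ℕ) : ℝ) = n + 1 from hJ]
    exact mul_le_mul_of_nonneg_right (by exact_mod_cast hKg) (by linarith)
  have hKJ0 : (0 : ℝ) ≤ (((schedKg m n + 1) * schedJ n : ℕ) : ℝ) := Nat.cast_nonneg _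
  set sδ : ℝ := δ n + ηA n + (2⁻¹ : ℝ) ^ n with hsδ
  have hs0 : 0 ≤ sδ := by positivity
  set W : ℝ := (24 * A + 2) * (n + 1) * (A + A' + 1) with hW
  -- term by term
  have t1 : (((schedKg m n + 1) * schedJ n : ℕ) : ℝ) * ((m n + NV n) * (δ n + 6 * (2⁻¹ : ℝ) ^ n)) ≤ W * (6 * sδ) := by
    have h6 : δ n + 6 * (2⁻¹ : ℝ) ^ n ≤ 6 * sδ := by rw [hsδ]; linarith
    calc _ ≤ ((24 * A + 2) * (n + 1)) * ((A + A' + 1) * (6 * sδ)) :=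
          mul_le_mul hKJ (mul_le_mul hNVm h6 (by positivity) (by positivity)) (by positivity) (by positivity)
      _ = _ := by rw [hW]; ring
  have t2 : (((schedKg m n + 1) * schedJ n : ℕ) : ℝ) * ηA n ≤ (24 * A + 2) * (n + 1) * sδ := by
    calc _ ≤ ((24 * A + 2) * (n + 1)) * ηA n := mul_le_mul_of_nonneg_right hKJ hηn
      _ ≤ _ := mul_le_mul_of_nonneg_left (by rw [hsδ]; linarith) (by positivity)
  have t3 : ((1 : ℝ) / 2) ^ schedJ n ≤ 1 * sδ := by rw [hsδ]; linarith
  have hW1 : (24 * A + 2) * (n + 1) ≤ W :=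
    le_mul_of_one_le_right (by positivity) (by linarith)
  calc _ ≤ W * (6 * sδ) + ((24 * A + 2) * (n + 1) * sδ + 1 * sδ) := add_le_add t1 (add_le_add t2 t3)
    _ = (6 * W + (24 * A + 2) * (n + 1) + 1) * sδ := by ring
    _ ≤ (7 * W + 1) * sδ := mul_le_mul_of_nonneg_right (by linarith) hs0
    _ = _ := by rw [hW]; ring

/-- **Eventually `≤ n^{-c}`** (the `SolvesBDD` format). [cite: Peikert2009, Prop. 3.2] -/
theorem eventually_failureBound_le {m NV : ℕ → ℕ} (hm : IsPolyBounded m) (hNV : IsPolyBounded NV)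
    {δ ηA : ℕ → ℝ} (hδ : IsNegligible δ) (hδ0 : ∀ n, 0 ≤ δ n) (hηA : IsNegligible ηA) (hηA0 : ∀ n, 0 ≤ ηA n)
    (c : ℕ) : ∀ᶠ n : ℕ in atTop, failureBound m NV δ ηA n ≤ 1 / (n : ℝ) ^ c :=
  eventually_le_of_isNegligible (isNegligible_failureBound hm hNV hδ hδ0 hηA hηA0) c

/-- `N_V(n) = 800000(n+1)` is polynomially bounded. [folklore] -/
theorem isPolyBounded_schedNV : IsPolyBounded schedNV :=
  ⟨800000 * (Polynomial.X + 1), fun n => by simp [schedNV]⟩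

/-! ### Prop. 3.2 for the idealised reduction, in the `SolvesBDD` format -/

/-- The side condition `√2·α(n) < f(n)√(log n)` holds eventually (`f → ∞`, `α < 1`). [folklore] -/
theorem eventually_sqrt_two_mul_lt {α f : ℕ → ℝ} (hα : ∀ᶠ n : ℕ in atTop, 0 < α n ∧ α n < 1)
    (hf : Tendsto f atTop atTop) :
    ∀ᶠ n : ℕ in atTop, Real.sqrt 2 * α n < f n * Real.sqrt (Real.log n) := by
  have hf2 : ∀ᶠ n : ℕ in atTop, 2 ≤ f n := hf.eventually_ge_atTop 2
  have hlog : ∀ᶠ n : ℕ in atTop, 1 ≤ Real.log n := by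
    filter_upwards [eventually_ge_atTop 3] with n hn
    rw [Real.le_log_iff_exp_le (by positivity)]
    have h3 : (3 : ℝ) ≤ n := by exact_mod_cast hn
    have := Real.exp_one_lt_d9
    linarith
  filter_upwards [hf2, hlog, hα] with n hfn hlogn hαn
  have hs2 : Real.sqrt 2 < 2 := by
    rw [Real.sqrt_lt' two_pos]; norm_num
  have hl1 : 1 ≤ Real.sqrt (Real.log n) := by rw [Real.one_le_sqrt]; exact hlogn
  nlinarith [hαn.1, hαn.2]

/-- **Peikert 2009, Prop. 3.2 — the idealised reduction solves `BDD` on admissible inputs with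
overwhelming probability, for any good family of verification tests.** Let `m` and `N_V` be polynomially
bounded, `α(n) ∈ (0,1)` eventually, `f → ∞`, `δ ≥ 0` and `η_A ≥ 0` negligible, and let `Acc n` be
verification tests on `N_V(n)` fine samples with false-acceptance `≤ η_A(n)` and false-rejection `≤ 1/7`
under every fine law `A^{(K)}_{s',Ψ̄_{β'}}`, `0 < β' ≤ α(n)` (eventually in `n`). Then for every `c`, for
all large `n`: on every `f`-admissible input `((B, x), r)` of dimension `n`, for every sampler `D` of
`L(B)*` within `δ(n)` of `D_{L(B)*,r}` and every oracle `F` solving `LWE_{q(n),Ψ̄_{α(n)}}` from `m(n)`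
samples with average-case probability `≥ 2/3`, `regevBDD` (schedule `K_g = 24m+1`, `J = n+1`) outputs the
`B`-coordinates of a closest vector with probability `≥ 1 - n^{-c}`.
[cite: Peikert2009, Prop. 3.2 with Prop. 2.8 (full version pp. 11–12); RegevLWE2009, Lemma 3.4] -/
theorem regevBDD_solves_eventually_of_test {q : ℕ → ℕ} [∀ n, NeZero (q n)] {α f : ℕ → ℝ} {m NV : ℕ → ℕ}
    (K : ℕ) [NeZero K] (hm : IsPolyBounded m) (hNV : IsPolyBounded NV)
    (hα : ∀ᶠ n : ℕ in atTop, 0 < α n ∧ α n < 1) (hf : Tendsto f atTop atTop)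
    {δ : ℕ → ℝ} (hδ : IsNegligible δ) (hδ0 : ∀ n, 0 ≤ δ n)
    (Acc : ∀ n, (Fin n → ZMod (q n)) → Set (Fin (NV n) → (Fin n → ZMod (q n)) × ZMod (q n * K)))
    {ηA : ℕ → ℝ} (hηA : IsNegligible ηA) (hηA0 : ∀ n, 0 ≤ ηA n)
    (hAcc : ∀ᶠ n : ℕ in atTop, ∀ β' : ℝ, 0 < β' → β' ≤ α n → ∀ s' : Fin n → ZMod (q n),
      (∀ c, c ≠ s' → ((iidPMF (lweSampleK (q n) K (discretizedGaussian (q n * K) β') s') (NV n)).toOuterMeasure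
        (Acc n c)).toReal ≤ ηA n) ∧
      ((iidPMF (lweSampleK (q n) K (discretizedGaussian (q n * K) β') s') (NV n)).toOuterMeasure
        (Acc n s')ᶜ).toReal ≤ 1 / 7) (c : ℕ) :
    ∀ᶠ n : ℕ in atTop, ∀ p : GapCVPInstance, ∀ hp : p.1.I.n = n, ∀ (hZ : IsZLattice ℝ p.1.I.lattice),
      BDDAdmissible q α f p →
      ∀ (D : PMF (dualLattice p.1.I.lattice)),
        D.tvDist (discreteGaussian (dualLattice p.1.I.lattice) p.2 0) ≤ δ n →
      ∀ (F : (Fin (m p.1.I.n) → (Fin p.1.I.n → ZMod (q p.1.I.n)) × ZMod (q p.1.I.n)) → Fin p.1.I.n → ZMod (q p.1.I.n)),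
        ENNReal.ofReal (2 / 3) ≤
          searchSuccessProb (discretizedGaussian (q p.1.I.n) (α p.1.I.n)) (m p.1.I.n) (fun B => PMF.pure (F B)) →
        ∃ κ : p.1.I.lattice, dist p.1.targetE κ = infDist p.1.targetE p.1.I.lattice ∧
          1 - 1 / (n : ℝ) ^ c ≤
            ((regevBDD (zBasis p.1.I) (dualZBasis p.1.I) (q p.1.I.n) K (m p.1.I.n) (NV p.1.I.n) (schedKg m p.1.I.n)
                (schedJ p.1.I.n) D p.1.targetE (α p.1.I.n) F (Acc p.1.I.n)).toOuterMeasure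
              {o | o = some (fun i => (zBasis p.1.I).repr κ i)}).toReal := by
  filter_upwards [eventually_failureBound_le hm hNV hδ hδ0 hηA hηA0 c, eventually_sqrt_two_mul_lt hα hf, hα,
    hAcc, eventually_ge_atTop 1] with n hbound hgapn hαn hAccn hn1 p hp hZ hadm D hD F hF
  subst hp
  obtain ⟨κ, hκ, hfail⟩ := toReal_regevBDD_ne_le_of_admissible p hadm hn1 hαn.1 hgapn D hD K (m p.1.I.n)
    (NV p.1.I.n) (schedKg m p.1.I.n) (schedJ p.1.I.n) F hF
    (by rw [schedKg]; omega) (by rw [schedKg]; omega) (Acc p.1.I.n) (hηA0 _) hAccn le_rfl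
  refine ⟨κ, hκ, ?_⟩
  have hcompl : {o : Option (Fin p.1.I.n → ℤ) | o = some (fun i => (zBasis p.1.I).repr κ i)} =
      {o | o ≠ some (fun i => (zBasis p.1.I).repr κ i)}ᶜ := by
    ext o; simp
  rw [hcompl, toReal_toOuterMeasure_compl']
  have hfb : failureBound m NV δ ηA p.1.I.n =
      ((schedKg m p.1.I.n + 1) * schedJ p.1.I.n : ℕ) * ((m p.1.I.n + NV p.1.I.n) * (δ p.1.I.n + 6 * (2⁻¹ : ℝ) ^ p.1.I.n)) +
        (((schedKg m p.1.I.n + 1) * schedJ p.1.I.n : ℕ) * ηA p.1.I.n + (1 / 2) ^ schedJ p.1.I.n) := rfl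
  linarith [hfail, hbound, hfb]

/-- **Peikert 2009, Prop. 3.2 — the idealised reduction with Regev's cosine test solves `BDD` on
admissible inputs with overwhelming probability.** As `regevBDD_solves_eventually_of_test` with
`Acc = acceptSet q 512 N_V θ_α`, `N_V(n) = 800000(n+1)` (`RegevVerificationTest.lean`; the side conditions
`4πe^{πα²} ≤ 512q` and `e^{-N_V e^{-2πα²}/128} ≤ 1/7` hold for `q ≥ 2`, `α < 1`, and
`η_A(n) = e^{-N_V(n)e^{-2πα(n)²}/32} ≤ 2⁻ⁿ` eventually).
[cite: Peikert2009, Prop. 3.2 with Prop. 2.8 (full version pp. 11–12); RegevLWE2009, Lemma 3.4] -/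
theorem regevBDD_solves_eventually {q : ℕ → ℕ} [∀ n, NeZero (q n)] {α f : ℕ → ℝ} {m : ℕ → ℕ}
    (hm : IsPolyBounded m) (hq : ∀ᶠ n : ℕ in atTop, 2 ≤ q n)
    (hα : ∀ᶠ n : ℕ in atTop, 0 < α n ∧ α n < 1) (hf : Tendsto f atTop atTop)
    {δ : ℕ → ℝ} (hδ : IsNegligible δ) (hδ0 : ∀ n, 0 ≤ δ n) (c : ℕ) :
    ∀ᶠ n : ℕ in atTop, ∀ p : GapCVPInstance, ∀ hp : p.1.I.n = n, ∀ (hZ : IsZLattice ℝ p.1.I.lattice),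
      BDDAdmissible q α f p →
      ∀ (D : PMF (dualLattice p.1.I.lattice)),
        D.tvDist (discreteGaussian (dualLattice p.1.I.lattice) p.2 0) ≤ δ n →
      ∀ (F : (Fin (m p.1.I.n) → (Fin p.1.I.n → ZMod (q p.1.I.n)) × ZMod (q p.1.I.n)) → Fin p.1.I.n → ZMod (q p.1.I.n)),
        ENNReal.ofReal (2 / 3) ≤
          searchSuccessProb (discretizedGaussian (q p.1.I.n) (α p.1.I.n)) (m p.1.I.n) (fun B => PMF.pure (F B)) →
        ∃ κ : p.1.I.lattice, dist p.1.targetE κ = infDist p.1.targetE p.1.I.lattice ∧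
          1 - 1 / (n : ℝ) ^ c ≤
            ((regevBDD (zBasis p.1.I) (dualZBasis p.1.I) (q p.1.I.n) schedK (m p.1.I.n) (schedNV p.1.I.n)
                (schedKg m p.1.I.n) (schedJ p.1.I.n) D p.1.targetE (α p.1.I.n) F
                (acceptSet (q p.1.I.n) schedK (schedNV p.1.I.n) (threshold (α p.1.I.n)))).toOuterMeasure
              {o | o = some (fun i => (zBasis p.1.I).repr κ i)}).toReal := by
  -- `η_A(n) = e^{-N_V(n)e^{-2πα(n)²}/32}` when `α(n) ∈ (0,1)`, `0` otherwise (a nonnegative negligible majorant)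
  classical
  set ηA : ℕ → ℝ := fun n => if 0 < α n ∧ α n < 1 then Real.exp (-(schedNV n * Real.exp (-(2 * π * α n ^ 2)) / 32))
    else 0 with hηAdef
  have hηA0 : ∀ n, 0 ≤ ηA n := fun n => by
    simp only [hηAdef]; split_ifs
    · exact (Real.exp_pos _).le
    · exact le_rfl
  have hηAle : ∀ n, ηA n ≤ (2⁻¹ : ℝ) ^ n := fun n => by
    simp only [hηAdef]; split_ifs with h
    · exact exp_schedNV_le_two_inv_pow n (by rw [abs_of_pos h.1]; exact h.2.le)
    · positivity
  have hhalf : IsNegligible fun n : ℕ => (2⁻¹ : ℝ) ^ n := fun c =>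
    tendsto_pow_const_mul_const_pow_of_abs_lt_one c (by rw [abs_of_pos (by positivity)]; norm_num)
  have hηA : IsNegligible ηA :=
    hhalf.trans_eventually_abs_le (Filter.Eventually.of_forall fun n => by
      simp only [Function.comp_apply]
      rw [abs_of_nonneg (hηA0 n), abs_of_nonneg (by positivity)]
      exact hηAle n)
  have hAcc : ∀ᶠ n : ℕ in atTop, ∀ β' : ℝ, 0 < β' → β' ≤ α n → ∀ s' : Fin n → ZMod (q n),
      (∀ c, c ≠ s' → ((iidPMF (lweSampleK (q n) schedK (discretizedGaussian (q n * schedK) β') s')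
        (schedNV n)).toOuterMeasure (acceptSet (q n) schedK (schedNV n) (threshold (α n)) c)).toReal ≤ ηA n) ∧
      ((iidPMF (lweSampleK (q n) schedK (discretizedGaussian (q n * schedK) β') s') (schedNV n)).toOuterMeasure
        (acceptSet (q n) schedK (schedNV n) (threshold (α n)) s')ᶜ).toReal ≤ 1 / 7 := by
    filter_upwards [hα, hq] with n hαn hqn β' hβ' hβ'α s'
    have hαabs : |α n| ≤ 1 := by rw [abs_of_pos hαn.1]; exact hαn.2.le
    have hβabs : |β'| ≤ α n := by rw [abs_of_pos hβ']; exact hβ'α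
    refine ⟨fun c' hc' => ?_, (toReal_reject_self_le_exp (q n) schedK hβabs (hqK_sched hqn hαabs) s'
      (schedNV n)).trans (hNV_sched n hαabs)⟩
    have h := toReal_accept_of_ne_le_exp (q n) schedK (α n) β' hc' (schedNV n)
    simp only [hηAdef, if_pos hαn]
    exact h
  exact regevBDD_solves_eventually_of_test schedK hm isPolyBounded_schedNV hα hf hδ hδ0
    (fun n => acceptSet (q n) schedK (schedNV n) (threshold (α n))) hηA hηA0 hAcc c

end Peikert2009

end Literature.Computability.Cryptography
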